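import Summits.QuantumFields.BalabanUV.Beta.NVertexSectorsPeriodised
import Summits.QuantumFields.BalabanUV.Beta.FP.TorusHSideJetPeriodic

/-!
# `BalabanUV.Beta.FP.TorusNBindingOfJunctions` — road «FP» for binder row D1, ROUTE T (β1), SPEC-48 §E (E4c) ∕ J-RISK-1′ (an2 g61 W-1 ∕ W-1′, l.67174 ∕ l.67194):
# **THE END WRAPPER's N-BINDING `hHN₁` FROM TWO JUNCTION WORDS AND A CONSTANT TREE-GAUGE READ-OUT** — the `X`-conjugation of `hH'₁f` VANISHES when the
# direction's tree-gauge read-out `lv v` is constant on the torus (in particular `lv := 0`), and then `hHN₁` at `v := dv n B (μ, y)` IS the W junction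
# (termwise `(−2c)·hb (n+1) v b = cE (n+2)·colN b`) plus the Λ junction (one matrix identity), by the row's PART 11 `perF_dper_VN_submatrix_ff_tower`

WHY.  The wrapper `StepRecursionFeedNestedNamedB.d1Tel_JcComp_ctr_named` (p405971 ✓) binds (`hHN₁`)
`H′₁f (dv (μ,y)) = (perF T (dper T (VN (Roots.ctr Lc) Pn (n+1) μ y)))|ff`, `H′₁f v = −(XᵀH₀) + H₁f v + H₀X`, `X = −(c • diagonal (lv v ∘ pr))` (`hH'₁f`),
`H₁f v = (−2c) • Σ_b hb (n+1) v b • W_b|ff + w (n+1) • Σ_ā hb (n+1) v ā • Λ_ā|ff + compSumSym …` (`hH₁f`).  LOCATED (g38, answering an2 g61's W-1 ∕ W-1′): the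
read-outs `lv ∕ Xbf` are FREE displayed data of the wrapper whose ONLY letters are linearity (`hlv ∕ hXbf`, l.159–162 of the wrapper) and which enter ONLY the
namings `hH'₁f hH'₂f h𝔔'₁f h𝔔'₂f`; so the (C1) instantiation may take them `0` (or any torus-constant read-out), under which the conjugation terms VANISH (§1,
`c·[diagonal λ, H₀] = 0` for constant `λ`) and `H′₁f = H₁f`.  The row's PART 10 ∕ 11 (an2 g61 `NVertexSectors` p465364 ✓, `NVertexSectorsPeriodised` ✓) put the
right side `(perF T (dper T (VN …)))|ff` in the shape `cE • Σ_b colN b • W_b|ff + cΛ • Σ_b colN b • (S^Λ_b)|ff` at the wrapper's finest torus with NO side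
condition (`perF_dper_VN_submatrix_ff_tower`), `colN b = (perF T (AN R (n+1))) ((b.1, inl b.2), (wrapPt T (Lc^{n+2}•y), inr μ))`.  THIS FILE assembles:
**`hHN1_shape_of_junctions`** — the `hHN₁`-shaped equation (its two sides VERBATIM after `rw [hH'₁f, hH₁f]`, `H₀` any matrix) FOLLOWS from (J0) the read-out is
constant on the torus, (J-W) the W junction TERMWISE `(−2·c)·hb (n+1) b = cE (n+2)·colN b` (J-RISK-1, the located scalar junction of an2 g61 INTENT-2), and (J-Λ)
the Λ junction `w (n+1) • Σ_ā hb (n+1) ā • Λ_ā|ff + compSumSym … = cΛ (n+2) • Σ_b colN b • (perF T (dper T (S^Λ_b)))|ff` (one matrix identity on the finest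
torus; by g36∕g37 its left side is `perF T (dper T (Σ_{j ≤ n+1} 𝒦_j))` and by `TorusCompanionCorePeriodic.perF_dper_core_of_biLoc` its right side is the
periodisation of ONE displayed lattice core — (E4b), the storey unrolling against F6a′∕F6a″∕F6a‴ ∕ PART 8, NOT here).  So J-RISK-1′ (where is the `X`-conjugation
matched?) is CLOSED on the road's side as OPTION (ii) of W-1: nothing on the row's two-sector `ff` block has to absorb it; the `λ̃`-currency of g38's
`TorusHSideJetConj{Periodic,Letters}` stays available for a non-constant read-out should J-RISK-1 ever force one.

WHAT ([folklore] matrix bookkeeping BY NAME; no `def`, no `def … : Prop`, nothing cited, 0 sorry): §1 `conj_eq_zero_of_const` (any index types, any `H₀`); §2 `wTerm_eq_of_junction` (a termwise scalar junction re-weights a torus-bond sum); §3 **`hHN1_shape_of_junctions`** (at the wrapper's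
objects: `T := towerTorus Lc (fine Lc M) (n+1)`, `R P`, depth `n+1`; generic `H₀ c w cf 𝒽 lev rs hb l N₁`).
WRAPPER DICTIONARY: `M := Mc B`, `hb k := hb n B k v`, `l := lv n B v` (`v := dv n B (μ, y)`), `H₀ := H₀ n B`, `c := c n`, `w := w n`, `cf k := cf n B k`,
`𝒽 μ y := symHessFFAt (toSite (ctrOff 4 Lc)) Lc μ y`, `N₁ := N`, `lev i := n+1−i`, `rs _ := ctrOff 4 Lc`, `R := Roots.ctr Lc`, `P := Pn`.
WHAT THIS IS NOT: not (J-W) itself (the torus nested minimiser column `hv ∕ hbtop` against the torus `ℋ`-column of the lattice N-chart — J-RISK-1, the road's ∕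
leaf-06's junction with an2's `AN`), not (J-Λ) ((E4b)), not a RULING that `lv := 0` is the instantiation of record (the road PROPOSES it — R-FP-77 in the journal —
and types its consequence; the wrapper is untouched and keeps `lv` displayed); no row of the END wrapper discharged; no estimate; nothing of Bałaban's asserted,
valued or discharged; 0∕4 row-D1 binders (hW, hR, D1Tel, D1Rep); ROOT M‴ p325680 untouched; NOT (C1), NOT (L2′), NOT (T-ID), NOT SDF, NOT D1, NOT BetaPertH,
NOT continuum, NOT Clay.

HONEST DEPENDENCY (page 1, mandatory): continuum YM on T⁴ ⇐ BetaPertH ∧ nine spine estimates (0/9 proved); BetaPertH ⇐ (D1) ∧ (D4) ∧ CAP+tail;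
G-an2-4 gates asym, D1 and NE2/3/4.  HONEST FRAMING (cell contract, verbatim): «discharging `BetaPertH` makes Bałaban's UV stability UNCONDITIONAL —
a real constructive-QFT result; it is NOT the continuum limit and NOT the Clay problem.»  ABSOLUTE RULE (cell charter, verbatim): «No internally-minted
statement may enter as a cited fact. Every hypothesis is either kernel-proved in this package or a verbatim quotation of a PUBLISHED theorem with page
reference. The manuscript(s) under audit are NOT citable for their own disputed steps — they are the thing under adjudication; programme-internal
(2001/route/tribunal) claims are never citable.»  Road «FP» OWNER, b2b-balaban-beta-d1-p3 gen 38, 2026-08-26.  No existing file touched.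
-/

noncomputable section

open scoped BigOperators

namespace Summit.QuantumFields.BalabanUV.Beta.FP.TorusNBindingOfJunctions

open Finset Matrix
open Literature.MathematicalPhysics.QuantumFieldTheory.Balaban1983to89 Literature.MathematicalPhysics.QuantumFieldTheory.Balaban1983to89.Beta
open B5Prop11Plancherel (fine)  open B6Lemma24Torus (pbox)
open AffineAveraging (Site)  open ExpKernelCalculus (MKer)  open OneStepResolventKernel (Fib KInv)  open InterLevelTransport (SLam)
open BalabanStepJets (lamCoeffOf)  open StepJetData (wilsonA)
open Summit.QuantumFields.BalabanUV.Beta.CompositeOneShotJets (compH)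
open Summit.QuantumFields.BalabanUV.Beta.CompositeOneShotJetData (Roots Pins AN VN)
open Summit.QuantumFields.BalabanUV.Beta.NVertexSectorsPeriodised (perF_dper_VN_submatrix_ff_tower)
open Summit.QuantumFields.BalabanUV.Beta.FP.KernelPeriodisationFib (Idx perF)
open Summit.QuantumFields.BalabanUV.Beta.FP.KernelPeriodisationFibLoc (dper)
open Summit.QuantumFields.BalabanUV.Beta.FP.TorusGaugeCovariancePairing (wrapPt)
open Summit.QuantumFields.BalabanUV.Beta.FP.TorusCompositeObjects (towerTorus)
open Summit.QuantumFields.BalabanUV.Beta.FP.TorusCompositeCompanionSumG (compSumSym)  open Summit.QuantumFields.BalabanUV.Beta.FP.TorusCompositeCompanionFamilyG (onTowerFamily)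

variable {d : ℕ}

/-! ## §1 The conjugation terms vanish for a torus-constant read-out -/

section Conj

variable {β γ : Type*} [Fintype β] [DecidableEq β]

/-- [folklore] **`c·[diagonal λ, H₀] = 0` FOR A CONSTANT READ-OUT**: `−((−(c • diagonal (λ ∘ pr)))ᵀ * H₀) + H₀ * (−(c • diagonal (λ ∘ pr))) = 0` whenever `λ` is
constant (entrywise `c·(λ (pr i) − λ (pr j))·H₀ i j`). -/
theorem conj_eq_zero_of_const (pr : β → γ) (l : γ → ℝ) (hl : ∀ r r' : γ, l r = l r') (c : ℝ) (H₀ : Matrix β β ℝ) :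
    -((-(c • Matrix.diagonal (fun b : β => l (pr b))))ᵀ * H₀) + H₀ * (-(c • Matrix.diagonal (fun b : β => l (pr b)))) = 0 := by
  rw [Matrix.transpose_neg, Matrix.transpose_smul, Matrix.diagonal_transpose, Matrix.neg_mul, neg_neg, Matrix.mul_neg, Matrix.smul_mul, Matrix.mul_smul]
  ext i j
  simp only [Matrix.add_apply, Matrix.neg_apply, Matrix.smul_apply, smul_eq_mul, Matrix.diagonal_mul, Matrix.mul_diagonal, Matrix.zero_apply, hl (pr i) (pr j)]
  ring

end Conj

/-! ## §2 A termwise scalar junction re-weights a torus-bond sum -/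

section WTerm

variable {β m n : Type*} [Fintype β]

/-- [folklore] **`wTerm_eq_of_junction`**: if `a·h b = a′·h′ b` for every torus bond `b`, then `a • Σ_b h b • X b = a′ • Σ_b h′ b • X b` for ANY family of matrices `X`. -/
theorem wTerm_eq_of_junction (a a' : ℝ) (h h' : β → ℝ) (hJ : ∀ b : β, a * h b = a' * h' b) (X : β → Matrix m n ℝ) :
    a • ∑ b : β, h b • X b = a' • ∑ b : β, h' b • X b := by
  simp_rw [Finset.smul_sum, smul_smul, hJ]

end WTerm

/-! ## §3 The `hHN₁`-shaped equation from (J0) + (J-W) + (J-Λ) at the wrapper's objects -/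

section Wrapper

variable {Lc : ℕ} [NeZero Lc] (R : Roots Lc) (P : Pins) (N₁ n : ℕ) (M : Fin (3 + 1) → ℕ) [∀ μ, NeZero (M μ)] (lev : ℕ → ℕ) (rs : ℕ → (Fin (3 + 1) → ℕ))
  (𝒽 : Fin (3 + 1) → Site (3 + 1) → MKer (3 + 1) (Fib 3))
  (cf : ℕ → Fin (3 + 1) → Site (3 + 1) → Fin (3 + 1) → Site (3 + 1) → ℝ) (w : ℕ → ℝ) (c : ℝ)
  (hb : (k : ℕ) → (↥(pbox (towerTorus Lc (fine Lc M) k)) × Fin (3 + 1) → ℝ))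
  (H₀ : Matrix (↥(pbox (towerTorus Lc (fine Lc M) (n + 1))) × Fin (3 + 1)) (↥(pbox (towerTorus Lc (fine Lc M) (n + 1))) × Fin (3 + 1)) ℝ)
  (l : ↥(pbox (towerTorus Lc (fine Lc M) (n + 1))) → ℝ) (μ : Fin (3 + 1)) (y : Site (3 + 1))
  -- (J0) the tree-gauge read-out along the direction is constant on the torus (in particular `0`)
  (hl : ∀ r r' : ↥(pbox (towerTorus Lc (fine Lc M) (n + 1))), l r = l r')
  -- (J-W) the W junction, TERMWISE: the storey-(n+1) direction re-weighted by `−2c` IS the torus `ℋ`-column of the N-chart re-weighted by `cE (n+2)` (J-RISK-1)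
  (hJW : ∀ b : ↥(pbox (towerTorus Lc (fine Lc M) (n + 1))) × Fin (3 + 1),
    (-2 * c) * hb (n + 1) b = P.cE (n + 1 + 1) * perF (towerTorus Lc (fine Lc M) (n + 1)) (AN R (n + 1)) (b.1, Sum.inl b.2)
      (wrapPt (towerTorus Lc (fine Lc M) (n + 1)) (((Lc ^ (n + 1 + 1) : ℕ) : ℤ) • y), Sum.inr μ))
  -- (J-Λ) the Λ junction: the wrapper's Λ terms (top storey + companion sum) ARE the periodised Λ sector of the N-vertex (ONE matrix identity; (E4b))
  (hJΛ : w (n + 1) • ∑ ā : ↥(pbox (towerTorus Lc (fine Lc M) (n + 1))) × Fin (3 + 1), hb (n + 1) ā •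
        (perF (towerTorus Lc (fine Lc M) (n + 1)) (dper (towerTorus Lc (fine Lc M) (n + 1)) (SLam N₁ (cf (n + 1)) 𝒽 ā.2 (ā.1 : Site (3 + 1))))).submatrix
          (fun p : ↥(pbox (towerTorus Lc (fine Lc M) (n + 1))) × Fin (3 + 1) => ((p.1, Sum.inl p.2) : Idx (towerTorus Lc (fine Lc M) (n + 1)) (Fib 3)))
          (fun p : ↥(pbox (towerTorus Lc (fine Lc M) (n + 1))) × Fin (3 + 1) => ((p.1, Sum.inl p.2) : Idx (towerTorus Lc (fine Lc M) (n + 1)) (Fib 3)))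
      + compSumSym Lc (onTowerFamily Lc (fine Lc M) (fun k => w k • ∑ ā : ↥(pbox (towerTorus Lc (fine Lc M) k)) × Fin (3 + 1), hb k ā •
        (perF (towerTorus Lc (fine Lc M) k) (dper (towerTorus Lc (fine Lc M) k) (SLam N₁ (cf k) 𝒽 ā.2 (ā.1 : Site (3 + 1))))).submatrix
          (fun p : ↥(pbox (towerTorus Lc (fine Lc M) k)) × Fin (3 + 1) => ((p.1, Sum.inl p.2) : Idx (towerTorus Lc (fine Lc M) k) (Fib 3)))
          (fun p : ↥(pbox (towerTorus Lc (fine Lc M) k)) × Fin (3 + 1) => ((p.1, Sum.inl p.2) : Idx (towerTorus Lc (fine Lc M) k) (Fib 3))))) (fine Lc M) lev rs (n + 1)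
    = P.cΛ (n + 1 + 1) • ∑ b : ↥(pbox (towerTorus Lc (fine Lc M) (n + 1))) × Fin (3 + 1),
        perF (towerTorus Lc (fine Lc M) (n + 1)) (AN R (n + 1)) (b.1, Sum.inl b.2)
            (wrapPt (towerTorus Lc (fine Lc M) (n + 1)) (((Lc ^ (n + 1 + 1) : ℕ) : ℤ) • y), Sum.inr μ) •
          (perF (towerTorus Lc (fine Lc M) (n + 1)) (dper (towerTorus Lc (fine Lc M) (n + 1))
            (SLam (Lc ^ (n + 1 + 1)) (lamCoeffOf (KInv (N := Lc ^ (n + 1 + 1)) (d := 3)) (Lc ^ (n + 1 + 1))) (compH R.r Lc (n + 1 + 1)) b.2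
              (b.1 : Site (3 + 1))))).submatrix
            (fun b : ↥(pbox (towerTorus Lc (fine Lc M) (n + 1))) × Fin (3 + 1) => ((b.1, Sum.inl b.2) : Idx (towerTorus Lc (fine Lc M) (n + 1)) (Fib 3)))
            (fun b : ↥(pbox (towerTorus Lc (fine Lc M) (n + 1))) × Fin (3 + 1) => ((b.1, Sum.inl b.2) : Idx (towerTorus Lc (fine Lc M) (n + 1)) (Fib 3))))
include hl hJW hJΛ

/-- [folklore] **`hHN1_shape_of_junctions` — THE N-BINDING's EQUATION FROM (J0) + (J-W) + (J-Λ)**: the `hHN₁`-shaped matrix equation (left side = `hH'₁f` with `hH₁f`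
substituted, `H₀` any matrix; right side = `(perF T (dper T (VN R P (n+1) μ y)))|ff`) HOLDS whenever the read-out `l` is constant on the torus, the W junction
holds termwise and the Λ junction holds as one matrix identity — the conjugation terms vanish (§1), the W term is re-weighted (§2), and the row's PART 11
`perF_dper_VN_submatrix_ff_tower` is the right side. -/
theorem hHN1_shape_of_junctions :
    -((-(c • Matrix.diagonal (fun b : ↥(pbox (towerTorus Lc (fine Lc M) (n + 1))) × Fin (3 + 1) => l b.1)))ᵀ * H₀)
      + ((-2 * c) • ∑ b : ↥(pbox (towerTorus Lc (fine Lc M) (n + 1))) × Fin (3 + 1), hb (n + 1) b •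
          (perF (towerTorus Lc (fine Lc M) (n + 1)) (dper (towerTorus Lc (fine Lc M) (n + 1)) (wilsonA 3 b.2 (b.1 : Site (3 + 1))))).submatrix
            (fun b : ↥(pbox (towerTorus Lc (fine Lc M) (n + 1))) × Fin (3 + 1) => ((b.1, Sum.inl b.2) : Idx (towerTorus Lc (fine Lc M) (n + 1)) (Fib 3)))
            (fun b : ↥(pbox (towerTorus Lc (fine Lc M) (n + 1))) × Fin (3 + 1) => ((b.1, Sum.inl b.2) : Idx (towerTorus Lc (fine Lc M) (n + 1)) (Fib 3)))
        + w (n + 1) • ∑ ā : ↥(pbox (towerTorus Lc (fine Lc M) (n + 1))) × Fin (3 + 1), hb (n + 1) ā •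
          (perF (towerTorus Lc (fine Lc M) (n + 1)) (dper (towerTorus Lc (fine Lc M) (n + 1)) (SLam N₁ (cf (n + 1)) 𝒽 ā.2 (ā.1 : Site (3 + 1))))).submatrix
            (fun b : ↥(pbox (towerTorus Lc (fine Lc M) (n + 1))) × Fin (3 + 1) => ((b.1, Sum.inl b.2) : Idx (towerTorus Lc (fine Lc M) (n + 1)) (Fib 3)))
            (fun b : ↥(pbox (towerTorus Lc (fine Lc M) (n + 1))) × Fin (3 + 1) => ((b.1, Sum.inl b.2) : Idx (towerTorus Lc (fine Lc M) (n + 1)) (Fib 3)))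
        + compSumSym Lc (onTowerFamily Lc (fine Lc M) (fun k => w k • ∑ ā : ↥(pbox (towerTorus Lc (fine Lc M) k)) × Fin (3 + 1), hb k ā •
          (perF (towerTorus Lc (fine Lc M) k) (dper (towerTorus Lc (fine Lc M) k) (SLam N₁ (cf k) 𝒽 ā.2 (ā.1 : Site (3 + 1))))).submatrix
            (fun b : ↥(pbox (towerTorus Lc (fine Lc M) k)) × Fin (3 + 1) => ((b.1, Sum.inl b.2) : Idx (towerTorus Lc (fine Lc M) k) (Fib 3)))
            (fun b : ↥(pbox (towerTorus Lc (fine Lc M) k)) × Fin (3 + 1) => ((b.1, Sum.inl b.2) : Idx (towerTorus Lc (fine Lc M) k) (Fib 3))))) (fine Lc M) lev rs (n + 1))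
      + H₀ * (-(c • Matrix.diagonal (fun b : ↥(pbox (towerTorus Lc (fine Lc M) (n + 1))) × Fin (3 + 1) => l b.1)))
      = (perF (towerTorus Lc (fine Lc M) (n + 1)) (dper (towerTorus Lc (fine Lc M) (n + 1)) (VN R P (n + 1) μ y))).submatrix
          (fun b : ↥(pbox (towerTorus Lc (fine Lc M) (n + 1))) × Fin (3 + 1) => ((b.1, Sum.inl b.2) : Idx (towerTorus Lc (fine Lc M) (n + 1)) (Fib 3)))
          (fun b : ↥(pbox (towerTorus Lc (fine Lc M) (n + 1))) × Fin (3 + 1) => ((b.1, Sum.inl b.2) : Idx (towerTorus Lc (fine Lc M) (n + 1)) (Fib 3))) := by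
  rw [add_right_comm, conj_eq_zero_of_const Prod.fst l hl c H₀, zero_add, add_assoc, hJΛ,
    wTerm_eq_of_junction (-2 * c) (P.cE (n + 1 + 1)) (hb (n + 1)) _ hJW]
  exact (perF_dper_VN_submatrix_ff_tower R P M n μ y).symm

end Wrapper

end Summit.QuantumFields.BalabanUV.Beta.FP.TorusNBindingOfJunctions

end
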